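import Summits.ValiantsHypothesis.ValiantsHypothesis.Theorems.KPlusLogSqLawOctaveExact
import Summits.ValiantsHypothesis.ValiantsHypothesis.Theorems.KPlusLogSqLawOctaveDefs
import Summits.ValiantsHypothesis.ValiantsHypothesis.Theorems.MatrixDescartes.Negative.MatrixDescartesSymmetryFree

/-!
# `KPlusLogSqLawOctave` — a tropical monster kills the octave programme at its SUMMIT GLUE Ω-MDR (support, sorry-free)

val-idea-11 g5 (lens wuc), addendum to the finding «octave-exact» (`Theorems/KPlusLogSqLawOctaveExact.lean`).

The octave route reaches `ValiantsHypothesis` through the window law **Ω-MDR** (`Octave.OctaveMatrixDescartes`: for all `c, q`,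
eventually in `K`, every real symmetric pencil of format `(m, K)` with `m ≤ 2^((log₂K + c)^c)` has `octaveCount^q ≤ 2^(K·log₂K)`;
glue `OctaveGlue.valiant_of_octaveMatrixDescartes`), which is WEAKER than the route's conjunction Ω-B (`octaveMatrixDescartes_of_octaveKLaw`).
The tree knows that a `TropicalMonster` (a designed integer patch family whose signed tropical chains beat `2^(K log K / q)` inside the
window) refutes the REAL crux `MatrixDescartes` (`MatrixDescartes_false_of_TropicalMonster`) and Tropical Conjecture B
(`not_tropicalMonster_of_tropKPlusLogSqLaw`).  This file closes the square on the octave side, one level BELOW Ω-B: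

* `not_tropicalMonster_of_octaveMatrixDescartes` : **Ω-MDR → ¬ TropicalMonster** — the octave patchworking of `…OctaveExact`
  (`octaves_of_signedChain` : a signed dominant chain of length `n+1` at format `(m, K)` forces `n` nonzero root OCTAVES of a real symmetric
  pencil of format `(2m, K+1)`) fed into Ω-MDR with the symmetric-doubling bookkeeping `(c, q) ↦ (c+1, 2q)` of
  `matrixDescartesGeneral_of_matrixDescartes` (`pow_succ_bookkeeping`);
* `octaveMatrixDescartes_false_of_tropicalMonster` (contrapositive) and the NAMED form over `Octave.OctaveMatrixDescartes`.

WUC READING.  `¬ TropicalMonster` (the tropical WINDOW law: chains `≤ 2^(K log₂K / q)` for `m ≤ 2^polylog K`) is the weakest tropical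
statement that EVERY door of the `K + log²` programme must prove — real (`MatrixDescartes`, Conjecture B) and octave (Ω-MDR, hence Ω-B,
hence `TropicalB ∧ Ω-W` by `OctaveExact.octaveKLaw_iff`) alike: a tropical monster is a universal refutation target, and coarsening
root counts to octaves buys no protection against it even at the glue level.  Nothing here asserts Ω-MDR, Ω-B, Ω-W or `TropicalB`;
VP ≠ VNP is not moved. [folklore] bookkeeping over tree lemmas.
-/

set_option linter.dupNamespace false
set_option autoImplicit false

namespace Summit.ValiantsHypothesis.ValiantsHypothesis.Theorems.KPlusLogSqLaw.OctaveMonster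

open Summit.ValiantsHypothesis.ValiantsHypothesis.Theorems.MatrixDescartes.Negative
  (TropicalMonster IsDominant termSign dD pow_succ_bookkeeping)
open Summit.ValiantsHypothesis.ValiantsHypothesis.Theorems.KPlusLogSqLaw.OctaveGlue (octaveCount)
open Polynomial

/-- **Ω-MDR ⇒ no tropical monster** (Ω-MDR in the unfolded glue form of `OctaveGlue.valiant_of_octaveMatrixDescartes`). [folklore] -/
theorem not_tropicalMonster_of_octaveMatrixDescartes
    (h : ∀ c q : ℕ, 0 < q → ∃ K₀ : ℕ, ∀ K m : ℕ, K₀ ≤ K → m ≤ 2 ^ ((Nat.log 2 K + c) ^ c) →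
      ∀ (d : Fin K → ℕ) (S : Fin K → Matrix (Fin m) (Fin m) ℝ), (∀ l, (S l).IsSymm) →
        octaveCount (Matrix.det (∑ l, ((Polynomial.X : Polynomial ℝ) ^ d l) • (S l).map Polynomial.C)) ^ q
          ≤ 2 ^ (K * Nat.log 2 K)) :
    ¬ TropicalMonster := by
  rintro ⟨c, q, hq, hall⟩
  obtain ⟨K₀, hK⟩ := h (c + 1) (2 * q) (by omega)
  obtain ⟨K, m, hKm, hm, d, v, ε, B, θ, p, hε, hθ, hdom, halt, hbig⟩ := hall (max K₀ 4)
  have hK4 : 4 ≤ K := le_of_max_le_right hKm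
  have hK₀ : K₀ ≤ K + 1 := by
    have := le_of_max_le_left hKm
    omega
  have hL2 : 2 ≤ Nat.log 2 K :=
    calc 2 = Nat.log 2 4 := by decide
      _ ≤ Nat.log 2 K := Nat.log_mono_right hK4
  have hLle : Nat.log 2 K ≤ Nat.log 2 (K + 1) := Nat.log_mono_right (Nat.le_succ K)
  have hL' : Nat.log 2 (K + 1) ≤ Nat.log 2 K + 1 :=
    calc Nat.log 2 (K + 1) ≤ Nat.log 2 (K * 2) := Nat.log_mono_right (by omega)
      _ = Nat.log 2 K + 1 := Nat.log_mul_base (by norm_num) (by omega)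
  have hsize : m + m ≤ 2 ^ ((Nat.log 2 (K + 1) + (c + 1)) ^ (c + 1)) :=
    calc m + m ≤ 2 ^ ((Nat.log 2 K + c) ^ c) + 2 ^ ((Nat.log 2 K + c) ^ c) := Nat.add_le_add hm hm
      _ = 2 ^ ((Nat.log 2 K + c) ^ c + 1) := by rw [pow_succ]; ring
      _ ≤ 2 ^ ((Nat.log 2 (K + 1) + (c + 1)) ^ (c + 1)) :=
          Nat.pow_le_pow_right (by norm_num) (pow_succ_bookkeeping _ _ c hL2 hLle)
  obtain ⟨S, hS, hn⟩ := OctaveExact.octaves_of_signedChain d v ε hε θ hθ p hdom halt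
  have h1 := hK (K + 1) (m + m) hK₀ hsize (dD d) S hS
  have h2 : (K + 1) * Nat.log 2 (K + 1) ≤ 2 * (K * Nat.log 2 K) := by
    calc (K + 1) * Nat.log 2 (K + 1) ≤ (K + 1) * (Nat.log 2 K + 1) := Nat.mul_le_mul_left _ hL'
      _ ≤ 2 * (K * Nat.log 2 K) := by nlinarith
  have h3 : (B ^ q) ^ 2 ≤ (2 ^ (K * Nat.log 2 K)) ^ 2 :=
    calc (B ^ q) ^ 2 = B ^ (2 * q) := by rw [← pow_mul, mul_comm]
      _ ≤ octaveCount (Matrix.det (∑ l, ((Polynomial.X : Polynomial ℝ) ^ dD d l) • (S l).map Polynomial.C)) ^ (2 * q) :=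
          Nat.pow_le_pow_left hn _
      _ ≤ 2 ^ ((K + 1) * Nat.log 2 (K + 1)) := h1
      _ ≤ 2 ^ (2 * (K * Nat.log 2 K)) := Nat.pow_le_pow_right (by norm_num) h2
      _ = (2 ^ (K * Nat.log 2 K)) ^ 2 := by rw [← pow_mul, mul_comm]
  exact absurd ((Nat.pow_le_pow_iff_left two_ne_zero).1 h3) (not_le.mpr hbig)

/-- **A tropical monster refutes Ω-MDR** — the octave twin of `MatrixDescartes_false_of_TropicalMonster`, one level below Ω-B. [folklore] -/
theorem octaveMatrixDescartes_false_of_tropicalMonster (hT : TropicalMonster) :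
    ¬ (∀ c q : ℕ, 0 < q → ∃ K₀ : ℕ, ∀ K m : ℕ, K₀ ≤ K → m ≤ 2 ^ ((Nat.log 2 K + c) ^ c) →
      ∀ (d : Fin K → ℕ) (S : Fin K → Matrix (Fin m) (Fin m) ℝ), (∀ l, (S l).IsSymm) →
        octaveCount (Matrix.det (∑ l, ((Polynomial.X : Polynomial ℝ) ^ d l) • (S l).map Polynomial.C)) ^ q
          ≤ 2 ^ (K * Nat.log 2 K)) :=
  fun h => not_tropicalMonster_of_octaveMatrixDescartes h hT

/-- the NAMED window law `Octave.OctaveMatrixDescartes` (…OctaveDefs) excludes tropical monsters. [folklore] -/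
theorem not_tropicalMonster_of_namedOctaveMatrixDescartes (h : Octave.OctaveMatrixDescartes) : ¬ TropicalMonster :=
  not_tropicalMonster_of_octaveMatrixDescartes h

/-- … and a tropical monster refutes it. [folklore] -/
theorem namedOctaveMatrixDescartes_false_of_tropicalMonster (hT : TropicalMonster) : ¬ Octave.OctaveMatrixDescartes :=
  fun h => not_tropicalMonster_of_octaveMatrixDescartes h hT

end Summit.ValiantsHypothesis.ValiantsHypothesis.Theorems.KPlusLogSqLaw.OctaveMonster
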